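import Summits.ResolutionOfSingularities.ResolutionOfSingularities.Theses.TeissierJung
import Summits.ResolutionOfSingularities.ResolutionOfSingularities.Theorems.TeissierJungTeissierReductionLowDim
import Literature.AlgebraicGeometry.Resolution.TeissierPresentation
import Literature.AlgebraicGeometry.Resolution.Principalization
import Literature.AlgebraicGeometry.Resolution.QuadraticTransforms
import HarnessLib

/-!
# Sketch — crux-ideate round 1, ideator 2, crux `TeissierReduction` (stmt-ResolutionOfSingularities-17085)

First lemmas of the two idea cards (statements must elaborate; proofs optional):

* card `toric-jung-newton-generic`: `teissierPresentation_binomialClean` — the terminal-point lemma of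
  the toric Jung game (a binomial-clean germ `z^q = c·x^A·(1+m)`, prime binomial, is Teissier-presented,
  `g = 1`, `h :=` the pure-`x` overweight part);
* card `valuative-koenig-surfaces`: `exists_iterated_quadraticTransform_monomial` (Zariski's
  monomialisation along a valuation in dimension two, over the tree's `IsQuadraticTransformAlong`);
* route-level note BN2 (relative crux; no card): `PrincipalizationInDim`, `TeissierReductionAmbient`,
  `JungTeissierStep`, `teissierReduction_iff_forall_ambient` (PROVED),
  `teissierReductionAmbient_of_le_four` (PROVED, mod `CossartPiltant2019`),
  `principalizationInDim_three` (PROVED from the named fact), `teissierReduction_of_ladder`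
  (PROVED, logic — shows the shape; NOTES.md explains why the ladder cannot feed
  `PrincipalizationInDim (d+1)` back without a roof/patching lemma);
* barrier note BN1: `not_teissierPresentation_bicyclic` / `teissierPresentation_bicyclic_overblown`
  (statements only).
-/

set_option linter.dupNamespace false

noncomputable section

open CategoryTheory AlgebraicGeometry TopologicalSpace
open Literature.AlgebraicGeometry.Resolution
open Literature.AlgebraicGeometry.Motives (projectiveSpace)
open Summit.ResolutionOfSingularities.ResolutionOfSingularities.Theses.TeissierJung

namespace Summit.ResolutionOfSingularities.ResolutionOfSingularities.Cruxes.TeissierReduction.Ideator2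

/-! ## Card A (`toric-jung-newton-generic`): the terminal-point lemma -/

/-- **Binomial-clean germs are Teissier-presented.** Over `Λ = k⟦x₁,…,x_d⟧`, the monogenic order
`Λ[z]/(z^q − c·x^A·(1 + m))` with `q ≥ 2`, `c ≠ 0`, `A ≠ 0`, `m ∈ (x)` and PRIME initial binomial
`z^q − c x^A` carries a Teissier presentation with `g = 1`, weight `v₀ = A/q`, tail
`h₀ := −c·x^A·m` (every monomial of `x^A m` has exponent `A + a`, `a ≠ 0`, i.e. weight `> A = q v₀`
in the product order). This is the shape of every terminal germ of the toric Jung game over a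
`p`-deficient edge after unit absorption. [folklore] -/
theorem teissierPresentation_binomialClean {k : Type} [Field k] {d : ℕ} (q : ℕ) (hq : 2 ≤ q)
    (c : k) (hc : c ≠ 0) (A : Fin d →₀ ℕ) (hA : A ≠ 0) (m : MvPowerSeries (Fin d) k)
    (hm : MvPowerSeries.constantCoeff m = 0)
    (hprime : (Ideal.span {(MvPolynomial.X (Sum.inr (0 : Fin 1)) ^ q -
        MvPolynomial.C c * MvPolynomial.monomial (A.sumElim (0 : Fin 1 →₀ ℕ)) 1 :
          MvPolynomial (Fin d ⊕ Fin 1) k)}).IsPrime) :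
    TeissierPresentation k d
      (MvPolynomial (Fin 1) (MvPowerSeries (Fin d) k) ⧸
        Ideal.span {(MvPolynomial.X 0 ^ q -
          MvPolynomial.C (MvPowerSeries.monomial A c * (1 + m)) :
            MvPolynomial (Fin 1) (MvPowerSeries (Fin d) k))})
      ((Ideal.Quotient.mk _).comp MvPolynomial.C) := by
  sorry

/-! ## Barrier note BN1: bicyclic Kummer points (statements only) -/

/-- **BN1 (negative).** The bicyclic Kummer point `Λ[y₁,y₂]/(y₁² − x₁, y₂² − x₂) ≅ k⟦y₁,y₂⟧` over
`Λ = k⟦x₁,x₂⟧` (char `≠ 2`) admits NO Teissier presentation: `IsDatum.weight_lt` forces the weights to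
form a chain in `ℚ²`, while the two Kummer directions have incomparable weights `e₁/2`, `e₂/2`; in the
linked form the branch would be monogenic over `Λ`, but `R/𝔪_Λ R = k[y₁,y₂]/(y₁²,y₂²)` has embedding
dimension `2`. [folklore] -/
theorem not_teissierPresentation_bicyclic {k : Type} [Field k] (h2 : (2 : k) ≠ 0) :
    ¬ TeissierPresentation k 2
      (MvPolynomial (Fin 2) (MvPowerSeries (Fin 2) k) ⧸ Ideal.span
        (Set.range fun i : Fin 2 => (MvPolynomial.X i ^ 2 - MvPolynomial.C (MvPowerSeries.X i) :
          MvPolynomial (Fin 2) (MvPowerSeries (Fin 2) k))))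
      ((Ideal.Quotient.mk _).comp MvPolynomial.C) := by
  sorry

/-- **BN1 (positive).** After over-blowing the base (`x₂ ↦ x₁ⁿ x₂`, `n ≥ 2`) the NON-normalised
fibre product `Λ[y₁,y₂]/(y₁² − x₁, y₂² − x₁ⁿ x₂)` IS Teissier-presented, in the loose form
(`E₀ = −(u₀² − x₁)` via `h₀ := u₁`, `E₁ = u₁² − x₁ⁿx₂`; weights `v₀ = (1/2,0) < (1,0) = 2v₀ ≤ v₁ =
(n/2,1/2)`). [folklore] -/
theorem teissierPresentation_bicyclic_overblown {k : Type} [Field k] (h2 : (2 : k) ≠ 0) (n : ℕ)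
    (hn : 2 ≤ n) :
    TeissierPresentation k 2
      (MvPolynomial (Fin 2) (MvPowerSeries (Fin 2) k) ⧸ Ideal.span
        ({MvPolynomial.X 0 ^ 2 - MvPolynomial.C (MvPowerSeries.X 0),
          MvPolynomial.X 1 ^ 2 - MvPolynomial.C (MvPowerSeries.X 0 ^ n * MvPowerSeries.X 1)} :
          Set (MvPolynomial (Fin 2) (MvPowerSeries (Fin 2) k))))
      ((Ideal.Quotient.mk _).comp MvPolynomial.C) := by
  sorry

/-! ## Card B (`valuative-koenig-surfaces`): Zariski's monomialisation along a valuation, dim 2 -/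

/-- **Zariski's lemma (first stub of the valuative line).** Along any valuation ring `O` of `K`
dominating a two-dimensional regular local ring `R ⊆ K`, finitely many non-zero elements of `R`
become units times monomials in a regular system of parameters of some ITERATED QUADRATIC
TRANSFORM of `R` along `O` (Zariski 1939/1944; Abhyankar 1956; the tree's
`IsQuadraticTransformAlong`, `QuadraticTransforms*.lean`). This is the engine that makes the
finitely many Mourtada–Schober stage data COMPARABLE (indeed divisibility-ordered) along every
valuation. [cite: ZariskiSamuel1960, Appendix 5] -/
theorem exists_iterated_quadraticTransform_monomial {K : Type} [Field K]
    (O : ValuationSubring K) (R : Subring K) [IsRegularLocalRing R]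
    (hdim : ringKrullDim R = 2) (hdom : SubringDominates R O.toSubring)
    {m : ℕ} (f : Fin m → R) (hf : ∀ j, f j ≠ 0) :
    ∃ (R₁ : Subring K) (h₁ : IsLocalRing R₁),
      Relation.ReflTransGen (IsQuadraticTransformAlong O) R R₁ ∧
      ∃ x y : R₁, @IsLocalRing.maximalIdeal R₁ _ h₁ = Ideal.span {x, y} ∧
        ∀ j, ∃ (a b : ℕ) (u : R₁), IsUnit u ∧ ((f j : K)) = (u : K) * (x : K) ^ a * (y : K) ^ b := by
  sorry

/-! ## Route-level note (was card `embedded-jung-ladder`, withdrawn to NOTES/BN2): the relative crux -/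

/-- **Principalization in dimension `d`** — the shape of Cossart–Piltant 2019 Prop. 4.4 (in tree as
the named fact `CossartPiltant2019Principalization`, the case `d = 3`) with `3 ↦ d`: on every regular
excellent integral Noetherian scheme of dimension `d`, every nonzero ideal sheaf is principalized by
a finite sequence of blowing ups along regular integral centres in its non-principal locus. Open for
`d ≥ 4` in characteristic `p`. [cite: CossartPiltant2019, Prop. 4.4 (arXiv v1: Prop. 4.3)] -/
def PrincipalizationInDim (d : ℕ) : Prop :=
  ∀ (S : Scheme.{0}) [IsIntegral S] [IsNoetherian S], Scheme.IsRegular S → Scheme.IsExcellent S →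
    topologicalKrullDim S = d → ∀ J : S.IdealSheafData, J ≠ ⊥ →
      ∃ (S' : Scheme.{0}) (σ : S' ⟶ S), IsRegularCentreBlowupSeq σ J ∧ IsLocallyPrincipal (J.comap σ)

/-- The base rung is the vendored named fact. [cite: CossartPiltant2019, Prop. 4.4] -/
theorem principalizationInDim_three (h : CossartPiltant2019Principalization.{0}) :
    PrincipalizationInDim 3 := by
  intro S _ _ hreg hexc hdim J hJ
  exact h S hreg hexc (by simpa using hdim) J hJ

/-- **The crux's conclusion in a fixed ambient dimension `m`** (`H ⊆ ℙᵐ_k`), with the let-bound `TF`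
replaced by the Literature predicate `TeissierPresented` (bridge `teissierPresented_iff`). [folklore] -/
def TeissierReductionAmbient (m : ℕ) : Prop :=
  ∀ p : ℕ, p.Prime → ∀ (k : Type) [Field k] [CharP k p] [IsAlgClosed k]
    (H : Scheme.{0}) (ι' : H ⟶ (projectiveSpace m k).left),
    IsClosedImmersion ι' → IsIntegral H →
    (∀ y : (projectiveSpace m k).left, ∃ U : (projectiveSpace m k).left.affineOpens,
      y ∈ (U : (projectiveSpace m k).left.Opens) ∧ (ι'.ker.ideal U).IsPrincipal) →
    ∃ (X' : Scheme.{0}) (ρ : X' ⟶ H), IsProper ρ ∧ IsBirational ρ ∧ TeissierPresented k X'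

/-- `TeissierReduction` is the conjunction of its fixed-ambient-dimension instances. [folklore] -/
theorem teissierReduction_iff_forall_ambient :
    TeissierReduction ↔ ∀ m, TeissierReductionAmbient m := by
  constructor
  · intro h m p hp k _ _ _ H ι' hι hH hpr
    obtain ⟨X', ρ, h1, h2, h3⟩ := h p hp k m H ι' hι hH hpr
    exact ⟨X', ρ, h1, h2, (teissierPresented_iff k X').2 h3⟩
  · intro h p hp k _ _ _ TF m H ι' hι hH hpr
    obtain ⟨X', ρ, h1, h2, h3⟩ := h m p hp k H ι' hι hH hpr
    exact ⟨X', ρ, h1, h2, (teissierPresented_iff k X').1 h3⟩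

/-- The rungs `m ≤ 4` are in tree (lead, p158399), modulo `CossartPiltant2019`. [folklore] -/
theorem teissierReductionAmbient_of_le_four (hCP : CossartPiltant2019.{0}) {m : ℕ} (hm : m ≤ 4) :
    TeissierReductionAmbient m := by
  intro p hp k _ _ _ H ι' hι hH _
  haveI := hι
  haveI := hH
  exact Theorems.TeissierReduction.teissierReduction_conclusion_of_le_four hCP (p := p) hm H ι'

/-- **The RELATIVE crux (one rung of the Jung ladder).** Principalization on regular `d`-folds ⇒
Teissier reduction for `d`-dimensional hypersurfaces `H ⊆ ℙ^{d+1}`: the discriminant / weighted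
coefficient ideals of a finite projection live on the `d`-dimensional regular base, so this is the
honest form of "Jung blows up only the base". [cite: MourtadaSchober2025, p. 4] -/
def JungTeissierStep (d : ℕ) : Prop :=
  PrincipalizationInDim d → TeissierReductionAmbient (d + 1)

/-- **Ladder assembly (logic only).** The crux follows from: the in-tree rungs `m ≤ 4`; the relative
rungs `JungTeissierStep d`, `d ≥ 4`; and principalization in every dimension `d ≥ 4` — the latter is
what the EMBEDDED half of the ladder (embedded Teissier reduction + Mourtada–Schober's embedded toric
resolution ⇒ ERS in ambient dimension `d+1` ⇒ principalization in dimension `d+1`) is to supply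
inductively from `PrincipalizationInDim 3` (`principalizationInDim_three`). [folklore] -/
theorem teissierReduction_of_ladder
    (hlow : ∀ m, m ≤ 4 → TeissierReductionAmbient m)
    (hprinc : ∀ d, 4 ≤ d → PrincipalizationInDim d)
    (hstep : ∀ d, 4 ≤ d → JungTeissierStep d) :
    TeissierReduction := by
  refine teissierReduction_iff_forall_ambient.2 fun m => ?_
  by_cases hm : m ≤ 4
  · exact hlow m hm
  · obtain ⟨d, rfl⟩ : ∃ d, m = d + 1 := ⟨m - 1, by omega⟩
    exact hstep d (by omega) (hprinc d (by omega))

end Summit.ResolutionOfSingularities.ResolutionOfSingularities.Cruxes.TeissierReduction.Ideator2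

end
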